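import Mathlib
import Summits.Ventures.PercRepro2.Defs
import Summits.Ventures.PercRepro2.Independence
import Summits.Ventures.PercRepro2.Harris
import Summits.Ventures.PercRepro2.Graph
import Summits.Ventures.PercRepro2.Events
import Summits.Ventures.PercRepro2.BoxUnionDefs
import Summits.Ventures.PercRepro2.BoxUnion
import Summits.Ventures.PercRepro2.BoxUnionPair
import Summits.Ventures.PercRepro2.CondAvoidPA

/-!
# The two-vertex status law is log-supermodular when the pair is not linkable
(blind cell PercRepro2, mine-1 g38; proofs/MINE1-PAIRTP2.md, Case B of (⟸))

For two observed vertices `u ≠ v`, the status law `pairLaw p ends {u, v} s t` on the (Z)-lattice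
lives on the nine points `ι(a, b)` of a `3 × 3` grid (`a, b ∈ Fin 3`: `2` = in `C_s`, `1` = in
neither cluster, `0` = in `C_t`), embedded by `iota` as a lattice homomorphism of
`Fin 3 × Fin 3` (product of chains) into `ZLat V`.  If `(u, v)` is NOT LINKABLE — no
configuration with `s ↮ t` has `u ∈ C_s, v ∈ C_t` or `v ∈ C_s, u ∈ C_t` — the corners
`M(2,0) = M(0,2) = 0` vanish, the only nontrivial `2 × 2` minors are the two central ones, and
these are the positive-association inequalities of `CondAvoidPA.pa_given_avoid_conn` (for
`s`, and for `t` by symmetry).  Hence (`pairLaw_lsm_of_not_linkable`) the status law is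
log-supermodular, and the union-row inequality `BoxUnionPair.hit_boxUnion_nonneg` holds for
all `f, g` increasing in the status of `C_s` and decreasing in that of `C_t`
(`hit_boxUnion_nonneg_of_not_linkable`).
-/

namespace Summit.Ventures.PercRepro2

namespace PairTP2

open Finset

/-! ### The abstract `3 × 3` lemma -/

/-- On the product of two three-element chains (`Fin 3`, `0 < 1 < 2`), a nonnegative function
vanishing at `(2, 0)` and `(0, 2)` and satisfying the two central minors is log-supermodular. -/
theorem lsm_of_minors (M : Fin 3 → Fin 3 → ℝ) (h0 : ∀ a b, 0 ≤ M a b)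
    (hST : M 2 0 = 0) (hTS : M 0 2 = 0)
    (hi : M 2 1 * M 1 2 ≤ M 2 2 * M 1 1) (hii : M 1 0 * M 0 1 ≤ M 1 1 * M 0 0)
    (a b a' b' : Fin 3) :
    M a b * M a' b' ≤ M (min a a') (min b b') * M (max a a') (max b b') := by
  have e1 := h0 1 1
  have e2 := h0 2 2
  have e3 := h0 0 0
  fin_cases a <;> fin_cases b <;> fin_cases a' <;> fin_cases b' <;>
    simp +decide only [Fin.isValue, Fin.mk_one, Fin.reduceFinMk, min_def, max_def, ite_true,
      ite_false, hST, hTS, zero_mul, mul_zero] <;>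
    first
    | exact le_rfl
    | exact mul_nonneg (h0 _ _) (h0 _ _)
    | linarith [mul_comm (M 2 1) (M 1 2), mul_comm (M 1 0) (M 0 1)]

/-- `⊓` on `Fin 3`: the meet is `2` iff both are. -/
lemma fin3_inf_eq_two (a b : Fin 3) : a ⊓ b = 2 ↔ a = 2 ∧ b = 2 := by revert a b; decide
/-- `⊓` on `Fin 3`: the meet is `0` iff one is. -/
lemma fin3_inf_eq_zero (a b : Fin 3) : a ⊓ b = 0 ↔ a = 0 ∨ b = 0 := by revert a b; decide
/-- `⊔` on `Fin 3`: the join is `2` iff one is. -/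
lemma fin3_sup_eq_two (a b : Fin 3) : a ⊔ b = 2 ↔ a = 2 ∨ b = 2 := by revert a b; decide
/-- `⊔` on `Fin 3`: the join is `0` iff both are. -/
lemma fin3_sup_eq_zero (a b : Fin 3) : a ⊔ b = 0 ↔ a = 0 ∧ b = 0 := by revert a b; decide
/-- An element of `Fin 3` is determined by whether it is `2` and whether it is `0`. -/
lemma fin3_eq_of_iff {a b : Fin 3} (h2 : a = 2 ↔ b = 2) (h0 : a = 0 ↔ b = 0) : a = b := by
  revert a b; decide

/-! ### The embedding of the grid into the (Z)-lattice -/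

section Embed

variable {V : Type*} [DecidableEq V]

/-- The grid point `(a, b)` as a pair of statuses of `u` and `v`: `W = {x ∈ {u,v} : code = 2}`,
`C = {x ∈ {u,v} : code = 0}`. -/
def iota (u v : V) (k : Fin 3 × Fin 3) : BoxUnionPair.ZLat V :=
  (({u, v} : Finset V).filter (fun x => (x = u ∧ k.1 = 2) ∨ (x = v ∧ k.2 = 2)),
   OrderDual.toDual (({u, v} : Finset V).filter (fun x => (x = u ∧ k.1 = 0) ∨ (x = v ∧ k.2 = 0))))

variable {u v : V}

/-- Membership in the first coordinate of a grid point. -/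
lemma mem_iota_fst (k : Fin 3 × Fin 3) (x : V) :
    x ∈ (iota u v k).1 ↔ (x = u ∧ k.1 = 2) ∨ (x = v ∧ k.2 = 2) := by
  simp only [iota, Finset.mem_filter, Finset.mem_insert, Finset.mem_singleton]
  constructor
  · rintro ⟨-, h⟩; exact h
  · intro h
    refine ⟨?_, h⟩
    rcases h with ⟨rfl, -⟩ | ⟨rfl, -⟩ <;> simp

/-- Membership in the second coordinate of a grid point. -/
lemma mem_iota_snd (k : Fin 3 × Fin 3) (x : V) :
    x ∈ OrderDual.ofDual (iota u v k).2 ↔ (x = u ∧ k.1 = 0) ∨ (x = v ∧ k.2 = 0) := by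
  simp only [iota, OrderDual.ofDual_toDual, Finset.mem_filter, Finset.mem_insert,
    Finset.mem_singleton]
  constructor
  · rintro ⟨-, h⟩; exact h
  · intro h
    refine ⟨?_, h⟩
    rcases h with ⟨rfl, -⟩ | ⟨rfl, -⟩ <;> simp

variable (hne : u ≠ v)
include hne

/-- `iota` is injective. -/
lemma iota_injective : Function.Injective (iota u v) := by
  intro k k' h
  have h1 := mem_iota_fst (u := u) (v := v) k u
  have h2 := mem_iota_fst (u := u) (v := v) k' u
  have h3 := mem_iota_snd (u := u) (v := v) k u
  have h4 := mem_iota_snd (u := u) (v := v) k' u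
  have h5 := mem_iota_fst (u := u) (v := v) k v
  have h6 := mem_iota_fst (u := u) (v := v) k' v
  have h7 := mem_iota_snd (u := u) (v := v) k v
  have h8 := mem_iota_snd (u := u) (v := v) k' v
  simp [hne, hne.symm] at h1 h2 h3 h4 h5 h6 h7 h8
  rw [h] at h1 h3 h5 h7
  refine Prod.ext (fin3_eq_of_iff ?_ ?_) (fin3_eq_of_iff ?_ ?_)
  · exact h1.symm.trans h2
  · exact h3.symm.trans h4
  · exact h5.symm.trans h6
  · exact h7.symm.trans h8

/-- `iota` preserves meets. -/
lemma iota_inf (k k' : Fin 3 × Fin 3) : iota u v (k ⊓ k') = iota u v k ⊓ iota u v k' := by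
  refine Prod.ext ?_ ?_
  · ext x
    rw [Prod.fst_inf, Finset.inf_eq_inter, Finset.mem_inter, mem_iota_fst, mem_iota_fst,
      mem_iota_fst]
    simp only [Prod.fst_inf, Prod.snd_inf, fin3_inf_eq_two]
    by_cases hxu : x = u
    · simp [hxu, hne]
    · by_cases hxv : x = v
      · simp [hxv, hne.symm]
      · simp [hxu, hxv]
  · apply OrderDual.ofDual.injective
    ext x
    rw [Prod.snd_inf]
    change x ∈ OrderDual.ofDual (iota u v (k ⊓ k')).2 ↔
      x ∈ OrderDual.ofDual (iota u v k).2 ∪ OrderDual.ofDual (iota u v k').2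
    rw [Finset.mem_union, mem_iota_snd, mem_iota_snd, mem_iota_snd]
    simp only [Prod.fst_inf, Prod.snd_inf, fin3_inf_eq_zero]
    by_cases hxu : x = u
    · simp [hxu, hne]
    · by_cases hxv : x = v
      · simp [hxv, hne.symm]
      · simp [hxu, hxv]

/-- `iota` preserves joins. -/
lemma iota_sup (k k' : Fin 3 × Fin 3) : iota u v (k ⊔ k') = iota u v k ⊔ iota u v k' := by
  refine Prod.ext ?_ ?_
  · ext x
    rw [Prod.fst_sup, Finset.sup_eq_union, Finset.mem_union, mem_iota_fst, mem_iota_fst,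
      mem_iota_fst]
    simp only [Prod.fst_sup, Prod.snd_sup, fin3_sup_eq_two]
    by_cases hxu : x = u
    · simp [hxu, hne]
    · by_cases hxv : x = v
      · simp [hxv, hne.symm]
      · simp [hxu, hxv]
  · apply OrderDual.ofDual.injective
    ext x
    rw [Prod.snd_sup]
    change x ∈ OrderDual.ofDual (iota u v (k ⊔ k')).2 ↔
      x ∈ OrderDual.ofDual (iota u v k).2 ∩ OrderDual.ofDual (iota u v k').2
    rw [Finset.mem_inter, mem_iota_snd, mem_iota_snd, mem_iota_snd]
    simp only [Prod.fst_sup, Prod.snd_sup, fin3_sup_eq_zero]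
    by_cases hxu : x = u
    · simp [hxu, hne]
    · by_cases hxv : x = v
      · simp [hxv, hne.symm]
      · simp [hxu, hxv]

end Embed

/-! ### The status code and the support of the status law -/

section Status

open scoped Classical

variable {V : Type*} {E : Type*} [Fintype V] [DecidableEq V] [Fintype E] [DecidableEq E]

/-- The status code of a vertex: `2` in `C_s`, `0` in `C_t` (and not in `C_s`), `1` otherwise. -/
noncomputable def code (ends : E → Sym2 V) (s t : V) (ω : Config E) (x : V) : Fin 3 :=
  if Conn ends ω s x then 2 else if Conn ends ω t x then 0 else 1

/-- The grid point of a configuration: the codes of `u` and `v`. -/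
noncomputable def grid (ends : E → Sym2 V) (s t u v : V) (ω : Config E) : Fin 3 × Fin 3 :=
  (code ends s t ω u, code ends s t ω v)

omit [DecidableEq E] in
/-- The code is `2` iff the vertex is in `C_s`. -/
lemma code_eq_two_iff (ends : E → Sym2 V) (s t : V) (ω : Config E) (x : V) :
    code ends s t ω x = 2 ↔ Conn ends ω s x := by
  unfold code
  split_ifs <;> simp [*]

omit [DecidableEq E] in
/-- The code is `0` iff the vertex is in `C_t` and not in `C_s`. -/
lemma code_eq_zero_iff (ends : E → Sym2 V) (s t : V) (ω : Config E) (x : V) :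
    code ends s t ω x = 0 ↔ ¬ Conn ends ω s x ∧ Conn ends ω t x := by
  unfold code
  split_ifs <;> simp [*]

omit [Fintype V] [DecidableEq V] [Fintype E] [DecidableEq E] in
/-- On `{s ↮ t}` a vertex connected to `t` is not connected to `s`. -/
lemma not_conn_s_of_conn_t {ends : E → Sym2 V} {s t x : V} {ω : Config E}
    (hQ : ω ∈ (connEvent ends s t)ᶜ) (h : Conn ends ω t x) : ¬ Conn ends ω s x :=
  fun h' => hQ (conn_trans h' (conn_symm h))

omit [DecidableEq E] in
/-- On `{s ↮ t}` the code is `0` iff the vertex is in `C_t`. -/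
lemma code_eq_zero_iff' {ends : E → Sym2 V} {s t : V} {ω : Config E}
    (hQ : ω ∈ (connEvent ends s t)ᶜ) (x : V) :
    code ends s t ω x = 0 ↔ Conn ends ω t x := by
  rw [code_eq_zero_iff]
  exact ⟨fun h => h.2, fun h => ⟨not_conn_s_of_conn_t hQ h, h⟩⟩

variable (ends : E → Sym2 V) (s t : V) {u v : V} (hne : u ≠ v)
include hne

omit [DecidableEq E] in
/-- On `{s ↮ t}` the status pair on `{u, v}` is the grid point of the configuration. -/
lemma status_eq_iota {ω : Config E} (hQ : ω ∈ (connEvent ends s t)ᶜ) :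
    BoxUnionPair.status ends {u, v} s t ω = iota u v (grid ends s t u v ω) := by
  unfold BoxUnionPair.status iota grid
  refine Prod.ext ?_ ?_
  · simp only
    refine Finset.filter_congr fun x hx => ?_
    simp only [Finset.mem_insert, Finset.mem_singleton] at hx
    rcases hx with rfl | rfl
    · simp [hne, code_eq_two_iff]
    · simp [hne.symm, code_eq_two_iff]
  · simp only
    congr 1
    refine Finset.filter_congr fun x hx => ?_
    simp only [Finset.mem_insert, Finset.mem_singleton] at hx
    rcases hx with rfl | rfl
    · simp [hne, code_eq_zero_iff' hQ]
    · simp [hne.symm, code_eq_zero_iff' hQ]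

variable {p : E → ℝ}

/-- The status law at a grid point is the probability of that grid value on `{s ↮ t}`. -/
lemma pairLaw_iota (k : Fin 3 × Fin 3) :
    BoxUnionPair.pairLaw p ends {u, v} s t (iota u v k) =
      prob p ({ω | grid ends s t u v ω = k} ∩ (connEvent ends s t)ᶜ) := by
  unfold BoxUnionPair.pairLaw prob
  refine Finset.sum_congr rfl fun ω _ => ?_
  by_cases hQ : ω ∈ (connEvent ends s t)ᶜ
  · by_cases hk : grid ends s t u v ω = k
    · have h1 : BoxUnionPair.status ends {u, v} s t ω = iota u v k := by
        rw [status_eq_iota ends s t hne hQ, hk]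
      have h2 : ω ∈ {ω | grid ends s t u v ω = k} ∩ (connEvent ends s t)ᶜ := ⟨hk, hQ⟩
      rw [if_pos ⟨h1, hQ⟩, Set.indicator_of_mem h2]
    · have h2 : ω ∉ {ω | grid ends s t u v ω = k} ∩ (connEvent ends s t)ᶜ := fun h => hk h.1
      have h1 : ¬ (BoxUnionPair.status ends {u, v} s t ω = iota u v k ∧
          ω ∈ (connEvent ends s t)ᶜ) := by
        rintro ⟨h, -⟩
        rw [status_eq_iota ends s t hne hQ] at h
        exact hk (iota_injective hne h)
      rw [if_neg h1, Set.indicator_of_notMem h2]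
  · have h2 : ω ∉ {ω | grid ends s t u v ω = k} ∩ (connEvent ends s t)ᶜ := fun h => hQ h.2
    rw [if_neg (fun h => hQ h.2), Set.indicator_of_notMem h2]

/-- The status law vanishes off the grid. -/
lemma pairLaw_eq_zero_of_not_grid (x : BoxUnionPair.ZLat V) (hx : ∀ k, iota u v k ≠ x) :
    BoxUnionPair.pairLaw p ends {u, v} s t x = 0 := by
  unfold BoxUnionPair.pairLaw
  refine Finset.sum_eq_zero fun ω _ => ?_
  have h1 : ¬ (BoxUnionPair.status ends {u, v} s t ω = x ∧ ω ∈ (connEvent ends s t)ᶜ) := by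
    rintro ⟨h, hQ⟩
    rw [status_eq_iota ends s t hne hQ] at h
    exact hx _ h
  rw [if_neg h1]

/-- **Transfer**: log-supermodularity of the grid function gives log-supermodularity of the
status law on the (Z)-lattice. -/
theorem pairLaw_lsm_of_grid (hp : IsProbVec p)
    (hM : ∀ k k' : Fin 3 × Fin 3,
      BoxUnionPair.pairLaw p ends {u, v} s t (iota u v k) *
          BoxUnionPair.pairLaw p ends {u, v} s t (iota u v k') ≤
        BoxUnionPair.pairLaw p ends {u, v} s t (iota u v (k ⊓ k')) *
          BoxUnionPair.pairLaw p ends {u, v} s t (iota u v (k ⊔ k')))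
    (x y : BoxUnionPair.ZLat V) :
    BoxUnionPair.pairLaw p ends {u, v} s t x * BoxUnionPair.pairLaw p ends {u, v} s t y ≤
      BoxUnionPair.pairLaw p ends {u, v} s t (x ⊓ y) *
        BoxUnionPair.pairLaw p ends {u, v} s t (x ⊔ y) := by
  have hnn := BoxUnionPair.pairLaw_nonneg (p := p) ends {u, v} s t hp
  by_cases hx : ∃ k, iota u v k = x
  · by_cases hy : ∃ k, iota u v k = y
    · obtain ⟨k, rfl⟩ := hx
      obtain ⟨k', rfl⟩ := hy
      rw [← iota_inf hne, ← iota_sup hne]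
      exact hM k k'
    · push Not at hy
      rw [pairLaw_eq_zero_of_not_grid ends s t hne y hy, mul_zero]
      exact mul_nonneg (hnn _) (hnn _)
  · push Not at hx
    rw [pairLaw_eq_zero_of_not_grid ends s t hne x hx, zero_mul]
    exact mul_nonneg (hnn _) (hnn _)

end Status

end PairTP2

end Summit.Ventures.PercRepro2
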